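import Summits.QuantumFields.GaugeBoot.Certificates.KZL2HD3TabA
import HarnessLib

/-!
# Kernel checks of the reduced problem family `KZL2HD3`, part 5/6 (gb_lean_emit_reduced 0.8.2)

HONEST FRAMING (cell `pub-gaugeboot`): certified bounds on lattice expectations at stated coupling,
gauge group, dimension and torus size; NOT a mass gap, NOT a continuum limit, NOT a string tension;
NOT Yang–Mills-summit-bearing (barriers `FixedCouplingUltralocality`, `PerturbativeInvisibility`).
Family `KZL2HD3` (1203 variables, 20 reduced blocks of dimensions `dimL`, max 20; signature sha256
`682e34515cd149e085710949d3f3196d00ca89cc3a94b13989283c4aa6a7b596`): the β-independent kernel checks of `Certificates/SparseReduced(Trace).lean`, run ONCE for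
every certificate of the family — `dimCheck` (entries outside a block's own dimension are empty), `shapeCheck`
(positions in range, strictly sorted ⇒ duplicate-free), `entCoverCheck` (every term of every entry is listed under its
variable) — held by `KZL2HD3TabA`, `KZL2HD3TabB`, `KZL2HD3TabC`, `KZL2HD3TabD`, `KZL2HD3TabE`, `KZL2HD3TabF` and assembled (`shape`, `cover`) in `KZL2HD3Tab`.
Nothing is claimed about lattice gauge theory in this file.
-/

namespace Summit.QuantumFields.GaugeBoot.Certificates.KZL2HD3

noncomputable section

open Matrix Summit.QuantumFields.GaugeBoot.Certificates.Sparse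

set_option maxHeartbeats 0 in
/-- Kernel check: every term of every block entry is listed under its variable, blocks `16 ≤ k < 17`. -/
theorem cover_14 : entCoverCheck EB P2 33 20 16 17 = true := by
  decide +kernel
set_option maxHeartbeats 0 in
/-- Kernel check: every term of every block entry is listed under its variable, blocks `17 ≤ k < 18`. -/
theorem cover_15 : entCoverCheck EB P2 33 20 17 18 = true := by
  decide +kernel
set_option maxHeartbeats 0 in
/-- Kernel check: every term of every block entry is listed under its variable, blocks `18 ≤ k < 19`. -/
theorem cover_16 : entCoverCheck EB P2 33 20 18 19 = true := by
  decide +kernel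

end

end Summit.QuantumFields.GaugeBoot.Certificates.KZL2HD3
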